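import Summits.AtomisticToContinuum.Crystallization.Theorems.PalmUnimodularRigidityShellsToBarlowChartTransportOpsDefs
import Summits.AtomisticToContinuum.Crystallization.Theorems.PalmUnimodularRigidityShellsToBarlowChartCharts
import Summits.AtomisticToContinuum.Crystallization.Theorems.PalmUnimodularRigidityShellsToBarlowChartTransportPatterns1
import Summits.AtomisticToContinuum.Crystallization.Theorems.PalmUnimodularRigidityShellsToBarlowChartTransportPatterns2
import Summits.AtomisticToContinuum.Crystallization.Theorems.PalmUnimodularRigidityShellsToBarlowChartTransportPatterns3
import Summits.AtomisticToContinuum.Crystallization.Theorems.PalmUnimodularRigidityShellsToBarlowChartTransportPatterns4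
import Summits.AtomisticToContinuum.Crystallization.Theorems.PalmUnimodularRigidityShellsToBarlowChartTransportPatterns5
import Summits.AtomisticToContinuum.Crystallization.Theorems.PalmUnimodularRigidityShellsToBarlowChartTransportPatterns6
import Summits.AtomisticToContinuum.Crystallization.Theorems.PalmUnimodularRigidityShellsToBarlowChartTransportPatterns7
import Summits.AtomisticToContinuum.Crystallization.Theorems.PalmUnimodularRigidityShellsToBarlowChartTransportPatterns8
import Summits.AtomisticToContinuum.Crystallization.Theorems.PalmUnimodularRigidityShellsToBarlowChartTransportPatterns9
import Summits.AtomisticToContinuum.Crystallization.Theorems.PalmUnimodularRigidityShellsToBarlowChartTransportPatterns10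
import Summits.AtomisticToContinuum.Crystallization.Theorems.PalmUnimodularRigidityShellsToBarlowChartTransportPatterns11
import Summits.AtomisticToContinuum.Crystallization.Theorems.PalmUnimodularRigidityShellsToBarlowChartTransportPatterns12
import Summits.AtomisticToContinuum.Crystallization.Theorems.PalmUnimodularRigidityShellsToBarlowChartTransportPatterns13
import Summits.AtomisticToContinuum.Crystallization.Theorems.PalmUnimodularRigidityShellsToBarlowChartTransportPatterns14
import Summits.AtomisticToContinuum.Crystallization.Theorems.PalmUnimodularRigidityShellsToBarlowChartTransportSteps1

/-!
# `CleanLimitsHaveWindows` (stmt-AtomisticToContinuum-15932), line `Sketch` — stub K1 (`stub_cleanChart`):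
# the transport development re-run on CLEAN charts — copy of `PalmUnimodularRigidityShellsToBarlowChartTransportSteps1`

This file is a mechanical copy of `Theorems/PalmUnimodularRigidityShellsToBarlowChartTransportSteps1.lean` (crux `ShellsToBarlowChart`,
route `PalmUnimodularRigidity`; original title: Line `develop-the-model-growth-descent` (crux `ShellsToBarlowChart`, stmt-AtomisticToContinuum-9227): the four in-layer transports `I, J, I⁻¹, J⁻¹` and the vertical transport `V` of frames read in integer charts (specifications, inverse identities, apexes) (part 1/7))
in which the chart hypothesis `hch : ∀ z ∈ S, IsZChart S z (ac z) (Pc z) (Ac z) (nb z)` (integer charts with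
`1 %` closeness) is replaced by the CLEAN-CHART hypothesis: at every site a labelling of the bonded neighbours
by `fcc3Int`/`hcpInt`, bijective, with bonds among neighbours = label pairs at squared distance `18`, together
with the TRANSFER property across every bond (proved for clean sets at matching radius `1/5` in
`…CleanChartTransfer`).  The original development uses its metric hypothesis only through the transfer
lemma, so all proofs go through verbatim; declarations live in the sub-namespace `….Clean` and shadow the
originals, the `hch`-free lemmas of the original file are reused, not restated.  All `[folklore]`.
-/

noncomputable section

namespace Summit.AtomisticToContinuum.Crystallization.Theorems.PalmUnimodularRigidityShellsToBarlowChart.Clean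

open Literature.Geometry.DiscreteGeometry Literature.MathematicalPhysics.StatisticalMechanics
open Summit.AtomisticToContinuum.Crystallization.Theorems.ShellsToBarlowChartNegative

variable {S : Set (EuclideanSpace ℝ (Fin 3))} {Pc : (EuclideanSpace ℝ (Fin 3)) → Finset (Fin 3 → ℤ)}
  {nb : (EuclideanSpace ℝ (Fin 3)) → (Fin 3 → ℤ) → (EuclideanSpace ℝ (Fin 3))}

/-- A labelled neighbour is a site of `S` bonded to the centre. [folklore] -/
theorem nb_mem (hch : ((∀ z ∈ S, (Pc z = fcc3Int ∨ Pc z = hcpInt) ∧ Set.BijOn (nb z) (↑(Pc z) : Set (Fin 3 → ℤ)) {y | y ∈ S ∧ (0 < dist z y ∧ dist z y ≤ 28 / 25)} ∧ (∀ t ∈ Pc z, ∀ t' ∈ Pc z, ((0 < dist (nb z t) (nb z t') ∧ dist (nb z t) (nb z t') ≤ 28 / 25) ↔ sqNormInt (t - t') = 18))) ∧ (∀ x ∈ S, ∀ y ∈ S, (0 < dist x y ∧ dist x y ≤ 28 / 25) → ∀ t ∈ Pc x, ∀ t' ∈ Pc x, ∀ u ∈ Pc y, ∀ u' ∈ Pc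 y, nb y u = nb x t → nb y u' = nb x t' → sqNormInt (u - u') = sqNormInt (t - t')))) {x : (EuclideanSpace ℝ (Fin 3))} (hx : x ∈ S)
    {t : Fin 3 → ℤ} (ht : t ∈ Pc x) : nb x t ∈ S ∧ (0 < dist x (nb x t) ∧ dist x (nb x t) ≤ 28 / 25) :=
  (hch.1 x hx).2.1.mapsTo ht

/-- The inverse labelling of a bonded neighbour is a label and labels it. [folklore] -/
theorem zlab_spec (hch : ((∀ z ∈ S, (Pc z = fcc3Int ∨ Pc z = hcpInt) ∧ Set.BijOn (nb z) (↑(Pc z) : Set (Fin 3 → ℤ)) {y | y ∈ S ∧ (0 < dist z y ∧ dist z y ≤ 28 / 25)} ∧ (∀ t ∈ Pc z, ∀ t' ∈ Pc z, ((0 < dist (nb z t) (nb z t') ∧ dist (nb z t) (nb z t') ≤ 28 / 25) ↔ sqNormInt (t - t') = 18))) ∧ (∀ x ∈ S, ∀ y ∈ S, (0 < dist x y ∧ dist x y ≤ 28 / 25) → ∀ t ∈ Pc x, ∀ t' ∈ Pc x, ∀ u ∈ Pc y, ∀ u' ∈ Pc y, nb y u = nb x t → nb y u' = nb x t' → sqNormInt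 (u - u') = sqNormInt (t - t')))) {y z : (EuclideanSpace ℝ (Fin 3))} (hy : y ∈ S)
    (hz : z ∈ S) (hb : 0 < dist y z ∧ dist y z ≤ 28 / 25) :
    zlab Pc nb y z ∈ Pc y ∧ nb y (zlab Pc nb y z) = z := by
  have hbij := (hch.1 y hy).2.1
  have hmem : z ∈ {w | w ∈ S ∧ (0 < dist y w ∧ dist y w ≤ 28 / 25)} := ⟨hz, hb⟩
  obtain ⟨t, ht, htz⟩ := hbij.surjOn hmem
  have hex : ∃ t ∈ (↑(Pc y) : Set (Fin 3 → ℤ)), nb y t = z := ⟨t, ht, htz⟩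
  exact ⟨Function.invFunOn_mem hex, Function.invFunOn_eq hex⟩

/-- The inverse labelling inverts the labelling on labels. [folklore] -/
theorem zlab_nb (hch : ((∀ z ∈ S, (Pc z = fcc3Int ∨ Pc z = hcpInt) ∧ Set.BijOn (nb z) (↑(Pc z) : Set (Fin 3 → ℤ)) {y | y ∈ S ∧ (0 < dist z y ∧ dist z y ≤ 28 / 25)} ∧ (∀ t ∈ Pc z, ∀ t' ∈ Pc z, ((0 < dist (nb z t) (nb z t') ∧ dist (nb z t) (nb z t') ≤ 28 / 25) ↔ sqNormInt (t - t') = 18))) ∧ (∀ x ∈ S, ∀ y ∈ S, (0 < dist x y ∧ dist x y ≤ 28 / 25) → ∀ t ∈ Pc x, ∀ t' ∈ Pc x, ∀ u ∈ Pc y, ∀ u' ∈ Pc y, nb y u = nb x t → nb y u' = nb x t' → sqNormInt (u - u') = sqNormInt (t - t')))) {y : (EuclideanSpace ℝ (Fin 3))} (hy : y ∈ S)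
    {t : Fin 3 → ℤ} (ht : t ∈ Pc y) : zlab Pc nb y (nb y t) = t :=
  (hch.1 y hy).2.1.invOn_invFunOn.1 ht

/-- Bonds among labelled neighbours are the label pairs at squared distance `18`. [folklore] -/
theorem bond_nb_iff (hch : ((∀ z ∈ S, (Pc z = fcc3Int ∨ Pc z = hcpInt) ∧ Set.BijOn (nb z) (↑(Pc z) : Set (Fin 3 → ℤ)) {y | y ∈ S ∧ (0 < dist z y ∧ dist z y ≤ 28 / 25)} ∧ (∀ t ∈ Pc z, ∀ t' ∈ Pc z, ((0 < dist (nb z t) (nb z t') ∧ dist (nb z t) (nb z t') ≤ 28 / 25) ↔ sqNormInt (t - t') = 18))) ∧ (∀ x ∈ S, ∀ y ∈ S, (0 < dist x y ∧ dist x y ≤ 28 / 25) → ∀ t ∈ Pc x, ∀ t' ∈ Pc x, ∀ u ∈ Pc y, ∀ u' ∈ Pc y, nb y u = nb x t → nb y u' = nb x t' → sqNormInt (u - u') = sqNormInt (t - t')))) {x : (EuclideanSpace ℝ (Fin 3))} (hx : x ∈ S)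
    {t t' : Fin 3 → ℤ} (ht : t ∈ Pc x) (ht' : t' ∈ Pc x) :
    (0 < dist (nb x t) (nb x t') ∧ dist (nb x t) (nb x t') ≤ 28 / 25) ↔ sqNormInt (t - t') = 18 :=
  (hch.1 x hx).2.2 t ht t' ht'

/-- The pattern of a chart is FCC or HCP. [folklore] -/
theorem pattern_cases (hch : ((∀ z ∈ S, (Pc z = fcc3Int ∨ Pc z = hcpInt) ∧ Set.BijOn (nb z) (↑(Pc z) : Set (Fin 3 → ℤ)) {y | y ∈ S ∧ (0 < dist z y ∧ dist z y ≤ 28 / 25)} ∧ (∀ t ∈ Pc z, ∀ t' ∈ Pc z, ((0 < dist (nb z t) (nb z t') ∧ dist (nb z t) (nb z t') ≤ 28 / 25) ↔ sqNormInt (t - t') = 18))) ∧ (∀ x ∈ S, ∀ y ∈ S, (0 < dist x y ∧ dist x y ≤ 28 / 25) → ∀ t ∈ Pc x, ∀ t' ∈ Pc x, ∀ u ∈ Pc y, ∀ u' ∈ Pc y, nb y u = nb x t → nb y u' = nb x t' → sqNormInt (u - u') = sqNormInt (t - t')))) {x : (EuclideanSpace ℝ (Fin 3))} (hx : x ∈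 S) :
    Pc x = fcc3Int ∨ Pc x = hcpInt := (hch.1 x hx).1

/-- Labels of a chart have squared norm `18`. [folklore] -/
theorem sqNormInt_of_label (hch : ((∀ z ∈ S, (Pc z = fcc3Int ∨ Pc z = hcpInt) ∧ Set.BijOn (nb z) (↑(Pc z) : Set (Fin 3 → ℤ)) {y | y ∈ S ∧ (0 < dist z y ∧ dist z y ≤ 28 / 25)} ∧ (∀ t ∈ Pc z, ∀ t' ∈ Pc z, ((0 < dist (nb z t) (nb z t') ∧ dist (nb z t) (nb z t') ≤ 28 / 25) ↔ sqNormInt (t - t') = 18))) ∧ (∀ x ∈ S, ∀ y ∈ S, (0 < dist x y ∧ dist x y ≤ 28 / 25) → ∀ t ∈ Pc x, ∀ t' ∈ Pc x, ∀ u ∈ Pc y, ∀ u' ∈ Pc y, nb y u = nb x t → nb y u' = nb x t' → sqNormInt (u - u') = sqNormInt (t - t')))) {x : (EuclideanSpace ℝ (Fin 3))} (hx : x ∈ S)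
    {t : Fin 3 → ℤ} (ht : t ∈ Pc x) : sqNormInt t = 18 := by
  rcases pattern_cases hch hx with h | h
  · rw [h] at ht; exact sqNormInt_of_mem_fcc3Int t ht
  · rw [h] at ht; exact sqNormInt_of_mem_hcpInt t ht

/-- **Transfer for two labelled neighbours of `x`** that are also bonded neighbours of the bonded
site `y`: their squared label distance at `y` is the one at `x` (the transfer clause of the clean-chart
hypothesis). [folklore] -/
theorem transfer_nb_nb (hch : ((∀ z ∈ S, (Pc z = fcc3Int ∨ Pc z = hcpInt) ∧ Set.BijOn (nb z) (↑(Pc z) : Set (Fin 3 → ℤ)) {y | y ∈ S ∧ (0 < dist z y ∧ dist z y ≤ 28 / 25)} ∧ (∀ t ∈ Pc z, ∀ t' ∈ Pc z, ((0 < dist (nb z t) (nb z t') ∧ dist (nb z t) (nb z t') ≤ 28 / 25) ↔ sqNormInt (t - t') = 18))) ∧ (∀ x ∈ S, ∀ y ∈ S, (0 < dist x y ∧ dist x y ≤ 28 / 25) → ∀ t ∈ Pc x, ∀ t' ∈ Pc x, ∀ u ∈ Pc y, ∀ u' ∈ Pc y, nb y u = nb x t → nb y u' = nb x t' → sqNormInt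 (u - u') = sqNormInt (t - t')))) {x y : (EuclideanSpace ℝ (Fin 3))}
    (hx : x ∈ S) (hy : y ∈ S) (hxy : 0 < dist x y ∧ dist x y ≤ 28 / 25)
    {t t' : Fin 3 → ℤ} (ht : t ∈ Pc x) (ht' : t' ∈ Pc x)
    (hzt : 0 < dist y (nb x t) ∧ dist y (nb x t) ≤ 28 / 25)
    (hzt' : 0 < dist y (nb x t') ∧ dist y (nb x t') ≤ 28 / 25) :
    sqNormInt (zlab Pc nb y (nb x t) - zlab Pc nb y (nb x t')) = sqNormInt (t - t') := by
  have h1 := zlab_spec hch hy (nb_mem hch hx ht).1 hzt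
  have h2 := zlab_spec hch hy (nb_mem hch hx ht').1 hzt'
  exact hch.2 x hx y hy hxy t ht t' ht' _ h1.1 _ h2.1 h1.2 h2.2

/-- **Transfer for a labelled neighbour of `x` and `x` itself**, read at the bonded site `y`: the two
labels touch (the neighbour is bonded to `x`), so the squared distance is `18 = sqNormInt t`. [folklore] -/
theorem transfer_nb_centre (hch : ((∀ z ∈ S, (Pc z = fcc3Int ∨ Pc z = hcpInt) ∧ Set.BijOn (nb z) (↑(Pc z) : Set (Fin 3 → ℤ)) {y | y ∈ S ∧ (0 < dist z y ∧ dist z y ≤ 28 / 25)} ∧ (∀ t ∈ Pc z, ∀ t' ∈ Pc z, ((0 < dist (nb z t) (nb z t') ∧ dist (nb z t) (nb z t') ≤ 28 / 25) ↔ sqNormInt (t - t') = 18))) ∧ (∀ x ∈ S, ∀ y ∈ S, (0 < dist x y ∧ dist x y ≤ 28 / 25) → ∀ t ∈ Pc x, ∀ t' ∈ Pc x, ∀ u ∈ Pc y, ∀ u' ∈ Pc y, nb y u = nb x t → nb y u' = nb x t' → sqNormInt (u - u') = sqNormInt (t - t')))) {x y : (EuclideanSpace ℝ (Fin 3))}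
    (hx : x ∈ S) (hy : y ∈ S) (hxy : 0 < dist x y ∧ dist x y ≤ 28 / 25)
    {t : Fin 3 → ℤ} (ht : t ∈ Pc x) (hzt : 0 < dist y (nb x t) ∧ dist y (nb x t) ≤ 28 / 25) :
    sqNormInt (zlab Pc nb y (nb x t) - zlab Pc nb y x) = sqNormInt t := by
  have h1 := zlab_spec hch hy (nb_mem hch hx ht).1 hzt
  have h2 := zlab_spec hch hy hx (bond_symm hxy)
  have hb : 0 < dist (nb x t) x ∧ dist (nb x t) x ≤ 28 / 25 := bond_symm (nb_mem hch hx ht).2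
  have h18 : sqNormInt (zlab Pc nb y (nb x t) - zlab Pc nb y x) = 18 :=
    (bond_nb_iff hch hy h1.1 h2.1).1 (by rw [h1.2, h2.2]; exact hb)
  rw [h18, sqNormInt_of_label hch hx ht]

/-- **Transfer for a labelled neighbour of `x` and `y` itself** (`y = nb x t₀`): the label of
`nb x t` at `y` has `sqNormInt = sqNormInt (t − t₀)` (both are `18`: the two points are bonded).
[folklore] -/
theorem transfer_nb_target (hch : ((∀ z ∈ S, (Pc z = fcc3Int ∨ Pc z = hcpInt) ∧ Set.BijOn (nb z) (↑(Pc z) : Set (Fin 3 → ℤ)) {y | y ∈ S ∧ (0 < dist z y ∧ dist z y ≤ 28 / 25)} ∧ (∀ t ∈ Pc z, ∀ t' ∈ Pc z, ((0 < dist (nb z t) (nb z t') ∧ dist (nb z t) (nb z t') ≤ 28 / 25) ↔ sqNormInt (t - t') = 18))) ∧ (∀ x ∈ S, ∀ y ∈ S, (0 < dist x y ∧ dist x y ≤ 28 / 25) → ∀ t ∈ Pc x, ∀ t' ∈ Pc x, ∀ u ∈ Pc y, ∀ u' ∈ Pc y, nb y u = nb x t → nb y u' = nb x t' → sqNormInt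 (u - u') = sqNormInt (t - t')))) {x : (EuclideanSpace ℝ (Fin 3))}
    (hx : x ∈ S) {t₀ t : Fin 3 → ℤ} (ht₀ : t₀ ∈ Pc x) (ht : t ∈ Pc x)
    (hzt : 0 < dist (nb x t₀) (nb x t) ∧ dist (nb x t₀) (nb x t) ≤ 28 / 25) :
    sqNormInt (zlab Pc nb (nb x t₀) (nb x t)) = sqNormInt (t - t₀) := by
  have hy := nb_mem hch hx ht₀
  have h1 := zlab_spec hch hy.1 (nb_mem hch hx ht).1 hzt
  have hr : sqNormInt (t - t₀) = 18 := by
    rw [sqNormInt_sub_comm]; exact (bond_nb_iff hch hx ht₀ ht).1 hzt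
  rw [sqNormInt_of_label hch hy.1 h1.1, hr]

/-- The label of the centre `x` at a labelled neighbour `y = nb x t₀` has squared norm `18`.
[folklore] -/
theorem sqNormInt_zlab_centre (hch : ((∀ z ∈ S, (Pc z = fcc3Int ∨ Pc z = hcpInt) ∧ Set.BijOn (nb z) (↑(Pc z) : Set (Fin 3 → ℤ)) {y | y ∈ S ∧ (0 < dist z y ∧ dist z y ≤ 28 / 25)} ∧ (∀ t ∈ Pc z, ∀ t' ∈ Pc z, ((0 < dist (nb z t) (nb z t') ∧ dist (nb z t) (nb z t') ≤ 28 / 25) ↔ sqNormInt (t - t') = 18))) ∧ (∀ x ∈ S, ∀ y ∈ S, (0 < dist x y ∧ dist x y ≤ 28 / 25) → ∀ t ∈ Pc x, ∀ t' ∈ Pc x, ∀ u ∈ Pc y, ∀ u' ∈ Pc y, nb y u = nb x t → nb y u' = nb x t' → sqNormInt (u - u') = sqNormInt (t - t')))) {x : (EuclideanSpace ℝ (Fin 3))}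
    (hx : x ∈ S) {t₀ : Fin 3 → ℤ} (ht₀ : t₀ ∈ Pc x) :
    sqNormInt (zlab Pc nb (nb x t₀) x) = 18 := by
  have hy := nb_mem hch hx ht₀
  have h := zlab_spec hch hy.1 hx (bond_symm hy.2)
  exact sqNormInt_of_label hch hy.1 h.1

/-- **The mirror-pair argument** (regime B): two common neighbours `u = nb x cu`, `l = nb x cl` of
`x, y = nb x t` with `sqNormInt (cu − cl) = 48` force `Pc y = hcpInt`, and a label at `y` touching both of
their labels is equatorial. [folklore] -/
theorem hcp_of_mirror_pair (hch : ((∀ z ∈ S, (Pc z = fcc3Int ∨ Pc z = hcpInt) ∧ Set.BijOn (nb z) (↑(Pc z) : Set (Fin 3 → ℤ)) {y | y ∈ S ∧ (0 < dist z y ∧ dist z y ≤ 28 / 25)} ∧ (∀ t ∈ Pc z, ∀ t' ∈ Pc z, ((0 < dist (nb z t) (nb z t') ∧ dist (nb z t) (nb z t') ≤ 28 / 25) ↔ sqNormInt (t - t') = 18))) ∧ (∀ x ∈ S, ∀ y ∈ S, (0 < dist x y ∧ dist x y ≤ 28 / 25) → ∀ t ∈ Pc x, ∀ t' ∈ Pc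 x, ∀ u ∈ Pc y, ∀ u' ∈ Pc y, nb y u = nb x t → nb y u' = nb x t' → sqNormInt (u - u') = sqNormInt (t - t')))) {x : (EuclideanSpace ℝ (Fin 3))}
    (hx : x ∈ S) {t cu cl : Fin 3 → ℤ} (ht : t ∈ Pc x) (hcu : cu ∈ Pc x) (hcl : cl ∈ Pc x)
    (h48 : sqNormInt (cu - cl) = 48)
    (hbu : 0 < dist (nb x t) (nb x cu) ∧ dist (nb x t) (nb x cu) ≤ 28 / 25)
    (hbl : 0 < dist (nb x t) (nb x cl) ∧ dist (nb x t) (nb x cl) ≤ 28 / 25) :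
    Pc (nb x t) = hcpInt ∧
      ∀ q ∈ Pc (nb x t), sqNormInt (q - zlab Pc nb (nb x t) (nb x cu)) = 18 →
        sqNormInt (q - zlab Pc nb (nb x t) (nb x cl)) = 18 → -q ∈ Pc (nb x t) := by
  have hy := nb_mem hch hx ht
  have hμ := zlab_spec hch hy.1 (nb_mem hch hx hcu).1 hbu
  have hlam := zlab_spec hch hy.1 (nb_mem hch hx hcl).1 hbl
  have D : sqNormInt (zlab Pc nb (nb x t) (nb x cu) - zlab Pc nb (nb x t) (nb x cl)) = 48 := by
    rw [transfer_nb_nb hch hx hy.1 hy.2 hcu hcl hbu hbl, h48]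
  have hPy : Pc (nb x t) = hcpInt := by
    rcases pattern_cases hch hy.1 with h | h
    · exfalso
      rw [h] at hμ hlam
      exact sqNormInt_sub_ne_48_of_fcc3Int _ hμ.1 _ hlam.1 D
    · exact h
  refine ⟨hPy, fun q hq h1 h2 => ?_⟩
  rw [hPy] at hq hμ hlam ⊢
  exact neg_mem_of_mirror_pair q hq _ hμ.1 _ hlam.1 h1 h2 D

end Summit.AtomisticToContinuum.Crystallization.Theorems.PalmUnimodularRigidityShellsToBarlowChart.Clean

end
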